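import Literature.NumberTheory.LFunctions.WeilExplicitProofs
import Literature.NumberTheory.LFunctions.WeilExplicitFormulaProofs
import Literature.NumberTheory.LFunctions.WeilGroundStateRealZerosProofs
import Literature.Analysis.Fourier.FourierCompactSupportAnalytic

/-!
# Zero side of the explicit formula at a ground state, under RH

Helper file for item stmt-RiemannHypothesis-1043 (`StrictUnderRH`, route WeilWindowFlow). With the
tree's PROVED explicit formula (`explicit_formula_holds`) and Bombieri's computation
`(g ⋆ g̃)^(ρ) = |ĝ(ρ)|²` on the critical line (`weilMellin_weilQuadratic_of_re_eq`):

* `mul_normSq_weilMellin_le_re_weilQuadratic` — under RH, for every test function `g` and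
  every zero `ρ` of `ζ` off the real axis, `m(ρ) |ĝ(ρ)|² ≤ Re Q(g)` (one non-negative term of the
  convergent zero side `Q(g) = Σ_ρ m(ρ)|ĝ(ρ)|²`, Bombieri 2000 §3 (3.2));
* `weilMellin_groundState_eq_zero` — hence if the bottom `ε(a) ≤ 0`, the transform `û` of a
  ground state `u` of the window (`IsWeilGroundState a u`, an `L²`-limit of a normalised minimising
  sequence `gₙ`, `Re Q(gₙ) → ε(a)`) vanishes at every such zero (`ĝₙ(ρ) → û(ρ)`);
* `exists_weilMellin_half_line_ne_zero` — `û` does not vanish identically on the critical line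
  (`L¹` Fourier uniqueness, `‖u‖₂ = 1`);
* `norm_weilMellin_half_add_le` — `‖û(1/2 + iz)‖ ≤ max(1, ‖u‖₁) e^{a |Im z|}` (exponential type `a`).

No definitions, no named facts.
-/

-- `Summit.RiemannHypothesis.RiemannHypothesis.…` repeats a namespace component by design (D-0017 layout).
set_option linter.dupNamespace false

noncomputable section

open Complex Filter Set MeasureTheory
open scoped Real Topology ComplexConjugate FourierTransform

namespace Summit.RiemannHypothesis.RiemannHypothesis.Theorems.WeilWindowFlowStrictUnderRH

open Literature.NumberTheory.LFunctions

/-! ## One term of the zero side -/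

/-- Under RH a zero `ρ` of `ζ` off the real axis is on the critical line. [folklore] -/
theorem re_eq_half_of_RH (hRH : _root_.RiemannHypothesis) {ρ : ℂ} (hζ : riemannZeta ρ = 0)
    (him : ρ.im ≠ 0) : ρ.re = 1 / 2 := by
  have hne : ρ ≠ 1 := by
    rintro rfl
    simp at him
  refine hRH ρ hζ ?_ hne
  rintro ⟨n, rfl⟩
  simp at him

/-- **One term of the zero side.** Under RH, for a test function `g` and a zero `ρ` of `ζ` with
`Im ρ ≠ 0`: `m(ρ) · |ĝ(ρ)|² ≤ Re Q(g)`. Indeed `Re Q(g) = lim_T Re ∑_{|Im ρ'| ≤ T} m(ρ') (g ⋆ g̃)^(ρ')`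
(`explicit_formula_holds`), every term is `m(ρ')|ĝ(ρ')|² ≥ 0` (`weilMellin_weilQuadratic_of_re_eq`),
and `ρ` is one of them once `T ≥ |Im ρ|`. (Bombieri 2000 §3, (3.2).) [cite: Bombieri2000Weil, §3 eq. (3.2)] -/
theorem mul_normSq_weilMellin_le_re_weilQuadratic (hRH : _root_.RiemannHypothesis) {g : ℝ → ℂ}
    (hg : IsWeilTest g) {ρ : ℂ} (hζ : riemannZeta ρ = 0) (him : ρ.im ≠ 0) :
    (riemannZetaZeroOrder ρ : ℝ) * Complex.normSq (weilMellin g ρ) ≤ (weilQuadratic g).re := by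
  classical
  have hk : IsWeilTest (weilConv g (weilReflect g)) := hg.weilConv hg.weilReflect
  have hlim : Tendsto (fun T ↦ (weilZeroSidePartial (weilConv g (weilReflect g)) T).re) atTop
      (𝓝 (weilQuadratic g).re) :=
    (Complex.continuous_re.tendsto _).comp (explicit_formula_holds hk)
  refine ge_of_tendsto hlim ?_
  filter_upwards [eventually_ge_atTop |ρ.im|] with T hT
  have hre : ρ.re = 1 / 2 := re_eq_half_of_RH hRH hζ him
  have hfin := weilZeroIndex_finite T
  have hmem : ρ ∈ hfin.toFinset := by
    rw [Set.Finite.mem_toFinset]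
    exact ⟨hζ, by rw [hre]; norm_num, by rw [hre]; norm_num, him, hT⟩
  unfold weilZeroSidePartial
  rw [finsum_mem_eq_finite_toFinset_sum _ hfin, Complex.re_sum]
  have hterm : ∀ ρ' ∈ hfin.toFinset,
      ((riemannZetaZeroOrder ρ' : ℂ) * weilMellin (weilConv g (weilReflect g)) ρ').re =
        (riemannZetaZeroOrder ρ' : ℝ) * Complex.normSq (weilMellin g ρ') := by
    intro ρ' hρ'
    rw [Set.Finite.mem_toFinset] at hρ'
    obtain ⟨hζ', -, -, him', -⟩ := hρ'
    rw [weilMellin_weilQuadratic_of_re_eq hg (re_eq_half_of_RH hRH hζ' him'),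
      ← Complex.ofReal_intCast, ← Complex.ofReal_mul, Complex.ofReal_re]
  rw [Finset.sum_congr rfl hterm]
  refine Finset.single_le_sum (f := fun ρ' ↦ (riemannZetaZeroOrder ρ' : ℝ) *
    Complex.normSq (weilMellin g ρ')) (fun ρ' hρ' ↦ ?_) hmem
  rw [Set.Finite.mem_toFinset] at hρ'
  obtain ⟨-, -, -, him', -⟩ := hρ'
  have hne : ρ' ≠ 1 := by
    rintro rfl
    simp at him'
  exact mul_nonneg (by exact_mod_cast riemannZetaZeroOrder_nonneg hne) (Complex.normSq_nonneg _)

/-! ## The transform of a ground state vanishes at the zeros when `ε(a) ≤ 0` -/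

/-- **If the bottom is `≤ 0`, the transform of a ground state vanishes at every zero of `ζ` off
the real axis (under RH).** For the minimising sequence `gₙ → u`: `|ĝₙ(ρ)|² ≤ m(ρ)|ĝₙ(ρ)|² ≤ Re Q(gₙ) → ε(a) ≤ 0`
and `ĝₙ(ρ) → û(ρ)` (`ConnesVanSuijlekom.tendsto_weilMellin`). [folklore] -/
theorem weilMellin_groundState_eq_zero (hRH : _root_.RiemannHypothesis) {a : ℝ} {u : ℝ → ℂ}
    (hu : IsWeilGroundState a u) (hε : weilGroundEnergy a ≤ 0) {ρ : ℂ}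
    (hζ : riemannZeta ρ = 0) (him : ρ.im ≠ 0) : weilMellin u ρ = 0 := by
  obtain ⟨g, hg, hQ, hL2⟩ := hu.2
  have hne : ρ ≠ 1 := by
    rintro rfl
    simp at him
  have hm : (1 : ℝ) ≤ riemannZetaZeroOrder ρ := by
    have h := (riemannZetaZeroOrder_pos_iff hne).2 hζ
    exact_mod_cast h
  have hle : ∀ n, Complex.normSq (weilMellin (g n) ρ) ≤ (weilQuadratic (g n)).re := by
    intro n
    have h := mul_normSq_weilMellin_le_re_weilQuadratic hRH (hg n).1 hζ him
    have h0 : 0 ≤ Complex.normSq (weilMellin (g n) ρ) := Complex.normSq_nonneg _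
    nlinarith
  have htend : Tendsto (fun n ↦ Complex.normSq (weilMellin (g n) ρ)) atTop
      (𝓝 (Complex.normSq (weilMellin u ρ))) :=
    (Complex.continuous_normSq.tendsto _).comp
      (ConnesVanSuijlekom.tendsto_weilMellin hu (fun n ↦ ⟨(hg n).1, (hg n).2.1⟩) hL2 ρ)
  have hlim : Complex.normSq (weilMellin u ρ) ≤ weilGroundEnergy a :=
    le_of_tendsto_of_tendsto' htend hQ hle
  have h0 : Complex.normSq (weilMellin u ρ) = 0 :=
    le_antisymm (hlim.trans hε) (Complex.normSq_nonneg _)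
  exact Complex.normSq_eq_zero.1 h0

/-! ## The transform of a ground state is not identically zero on the critical line -/

/-- The Fourier transform of `u` is its Weil transform on the critical line:
`𝓕 u w = û(1/2 − 2πw·i)`. [folklore] -/
theorem fourier_eq_weilMellin (u : ℝ → ℂ) (w : ℝ) :
    𝓕 u w = weilMellin u (1 / 2 + ((-(2 * π * w) : ℝ) : ℂ) * I) := by
  rw [Literature.Analysis.Fourier.fourier_eq_fourierLaplace]
  unfold weilMellin
  congr 1
  funext v
  rw [mul_comm]
  congr 1
  push_cast
  ring_nf

/-- **A ground state has a transform that is not identically zero on the critical line**: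
there is `ξ ∈ ℝ` with `û(1/2 + iξ) ≠ 0`. Otherwise `𝓕 u = 0`, so `u = 0` a.e. by `L¹` Fourier
uniqueness (`Literature.Analysis.Fourier.ae_eq_zero_of_forall_fourier_eq_zero`), contradicting
`∫ |u|² = 1`. [folklore] -/
theorem exists_weilMellin_half_line_ne_zero {a : ℝ} {u : ℝ → ℂ} (hu : IsWeilGroundState a u) :
    ∃ ξ : ℝ, weilMellin u (1 / 2 + (ξ : ℂ) * I) ≠ 0 := by
  by_contra h
  push Not at h
  have hF : ∀ w : ℝ, 𝓕 u w = 0 := fun w ↦ by rw [fourier_eq_weilMellin]; exact h _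
  have hae : u =ᵐ[volume] 0 :=
    Literature.Analysis.Fourier.ae_eq_zero_of_forall_fourier_eq_zero hu.integrable hF
  have h1 : ∫ t, ‖u t‖ ^ 2 = (1 : ℝ) := hu.integral_norm_sq
  have h0 : ∫ t, ‖u t‖ ^ 2 = (0 : ℝ) := by
    rw [← integral_zero ℝ ℝ]
    refine integral_congr_ae ?_
    filter_upwards [hae] with t ht
    simp [ht]
  linarith

/-! ## Exponential type of the transform of a ground state -/

/-- **Exponential type `a`**: for a ground state `u` of the window `[-a, a]`,
`‖û(1/2 + iz)‖ ≤ max(1, ∫|u|) · e^{a |Im z|}` (`u = 0` a.e. off the window,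
`|e^{izt}| = e^{-t Im z} ≤ e^{a|Im z|}` on it). [folklore] -/
theorem norm_weilMellin_half_add_le {a : ℝ} {u : ℝ → ℂ} (hu : IsWeilGroundState a u) (z : ℂ) :
    ‖weilMellin u (1 / 2 + z * I)‖ ≤ max 1 (∫ t, ‖u t‖) * Real.exp (a * |z.im|) := by
  have ha : 0 < a := hu.pos
  unfold weilMellin
  have hbound : ∀ᵐ t ∂volume, ‖u t * cexp ((1 / 2 + z * I - 1 / 2) * t)‖ ≤
      ‖u t‖ * Real.exp (a * |z.im|) := by
    filter_upwards [hu.ae_eq_zero_of_notMem] with t ht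
    by_cases hts : t ∈ Icc (-a) a
    · rw [norm_mul, Complex.norm_exp]
      refine mul_le_mul_of_nonneg_left (Real.exp_le_exp.2 ?_) (norm_nonneg _)
      have hre : ((1 / 2 + z * I - 1 / 2) * (t : ℂ)).re = -z.im * t := by
        simp [mul_re]
      rw [hre]
      have h1 : -z.im * t ≤ |z.im| * |t| := by
        rw [← abs_neg z.im, ← abs_mul]; exact le_abs_self _
      have h2 : |t| ≤ a := abs_le.2 ⟨hts.1, hts.2⟩
      nlinarith [abs_nonneg z.im]
    · rw [ht hts]
      simp only [zero_mul, norm_zero]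
      positivity
  have hint : Integrable (fun t ↦ ‖u t‖ * Real.exp (a * |z.im|)) := hu.integrable.norm.mul_const _
  calc ‖∫ t, u t * cexp ((1 / 2 + z * I - 1 / 2) * t)‖
      ≤ ∫ t, ‖u t‖ * Real.exp (a * |z.im|) := norm_integral_le_of_norm_le hint hbound
    _ = (∫ t, ‖u t‖) * Real.exp (a * |z.im|) := integral_mul_const _ _
    _ ≤ max 1 (∫ t, ‖u t‖) * Real.exp (a * |z.im|) :=
        mul_le_mul_of_nonneg_right (le_max_right _ _) (Real.exp_pos _).le

end Summit.RiemannHypothesis.RiemannHypothesis.Theorems.WeilWindowFlowStrictUnderRH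

end
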